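import Summits.QuantumAdvantage.QuantumAdvantage.Theorems.CubicForrelationNearExactIsExactTwelveBetaDead
import Summits.QuantumAdvantage.QuantumAdvantage.Theorems.CubicForrelationNearExactIsExactFourteenSecondBent

/-!
# Crux `CubicForrelation.NearExactIsExact` (stmt-QuantumAdvantage-14043) — n = 12, configuration `#Z = 768` at level `≥ 6`:
  small off-`Z` energy forces `4 ∣ e` off `Z`

Certificate seat `b2b-cforr-cert` (gen 26).  HONEST FRAMING: a finite-slice structure lemma (standard axioms) about cubic Boolean functions on
12 bits; it claims NO value of `θ₁₂`.  NOT summit progress.  Second brick of the `#Z = 768` analysis of the open window `57/64 < Φ < 29/32`.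

Setting: `W_g = 64u''` (`g` cubic), `Z = {u'' even}` with `#Z = 768` (so `Z = ⊔ᵢ mᵢ ⊕ P` over six cosets of the period group `P`,
`#P = 128`, gen 25's `tbc_*`), `f` cubic, `e = u'' − (−1)^f` (even off `Z`).

THEOREM `tzo_off_div4`: if the off-`Z` energy `Σ_{x ∉ Z} e(x)²` is `≤ 63`, then `4 ∣ e` off `Z`.
Proof.  Let `y₀ ∉ Z` with `e(y₀) ≡ 2 (mod 4)`.  By counting (`4096 > 128 + 768`, `4096 > 256 + 768 + 768`) there are directions `d₁, d₂` with
`d₁ ∉ P`, `d₂ ∉ P ⊕ {0, d₁}` and `y₀ ⊕ d₁, y₀ ⊕ d₂, y₀ ⊕ d₁ ⊕ d₂ ∉ Z`; then `V₉ := P ⊕ ⟨d₁, d₂⟩` is xor-closed with `2⁹` elements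
(`fo_double_closed` twice) and the 9-flat `F := y₀ ⊕ V₉` is disjoint from `Z` (`Z` is `P`-stable).  On `F` the residual is even and its
parametrised 6-flat sums are `≡ 0 (mod 4)` (`gh_flat_dvd`: `fs_flat_sum_dvd` + Ax), so one round of wild-point parity (`ws_erm_round`, Reed–Muller
distance `2^{9−5}` on the abstract 9-flat) makes `e/2` odd on `≥ 16` points of `F`, each costing `e² ≥ 4`: off-`Z` energy `≥ 64`.  Contradiction.

Use (…TwelveZ768WindowGt920): with `Σ e² = 8192(1 − Φ)` and `Σ_Z e² ≥ 768`, the off-`Z` energy is `< 64` as soon as `Φ > 920/1024`, and then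
gen 26's `tzd_Z768_div4_false` kills the side.

References: MacWilliams–Sloane (1977) Ch. 13 §3 (Reed–Muller codes on a flat), Ch. 15; R. O'Donnell (2014) §3.3.  Axioms: the standard three.
-/

set_option linter.dupNamespace false -- D-0017: single-problem summit ⇒ `QuantumAdvantage.QuantumAdvantage` by design

noncomputable section

namespace Summit.QuantumAdvantage.QuantumAdvantage.Theorems.CubicForrelation.NearExactIsExact

open Finset
open Literature.Computability.QuantumComplexity
open Literature.Computability.QuantumComplexity.BuzetChailloux (bxor zeroVec bxor_bxor_cancel_left bxor_zeroVec zeroVec_bxor bxor_comm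
  bxor_self)
open Literature.Computability.QuantumComplexity.DerivativeWalsh (W)

/-- **Exact doubling.**  For `⊕`-closed `U` and `t ∉ U`, `#(U ∪ (t ⊕ U)) = 2·#U`. [folklore] -/
theorem tzo_double_card {n : ℕ} (U : Finset (Fin n → Bool)) (hadd : ∀ a ∈ U, ∀ b ∈ U, bxor a b ∈ U)
    (t : Fin n → Bool) (ht : t ∉ U) : #(U ∪ U.image (bxor t)) = 2 * #U := by
  classical
  have hdisj : Disjoint U (U.image (bxor t)) := by
    rw [Finset.disjoint_left]
    intro x hx hx'
    obtain ⟨b, hb, hbx⟩ := mem_image.1 hx'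
    apply ht
    have h := hadd x hx b hb
    rw [← hbx, iw_bxor_assoc, bxor_self, bxor_zeroVec] at h
    exact h
  rw [card_union_of_disjoint hdisj, card_image_of_injective _ (iw_bxor_injective t)]
  ring

/-- **Small off-`Z` energy forces `4 ∣ e` off `Z`** for a level-`≥ 6` side with `#Z = 768` (module docstring).  Finite-slice statement,
NOT summit progress. [this work] -/
theorem tzo_off_div4 (f g : (Fin (6 + 6) → Bool) → Bool) (hf : IsDegLeFun 3 f) (hg : IsDegLeFun 3 g)
    (u'' : (Fin (6 + 6) → Bool) → ℤ) (hu'' : ∀ x, W (fun y => signOf (g y)) x = (2 : ℝ) ^ 6 * (u'' x : ℝ))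
    (h768 : #(univ.filter fun x : Fin (6 + 6) → Bool => ¬ Odd (u'' x)) = 768)
    (hoff : ∑ x ∈ univ.filter (fun x => x ∉ univ.filter (fun x : Fin (6 + 6) → Bool => ¬ Odd (u'' x))),
      (u'' x - sZ (f x)) ^ 2 ≤ 63) :
    ∀ y, y ∉ (univ.filter fun x : Fin (6 + 6) → Bool => ¬ Odd (u'' x)) → (4 : ℤ) ∣ u'' y - sZ (f y) := by
  classical
  set Z := univ.filter (fun x : Fin (6 + 6) → Bool => ¬ Odd (u'' x)) with hZdef
  set P := (univ.filter fun a : Fin (6 + 6) → Bool => ∀ x, decide (Odd (u'' (bxor x a))) = decide (Odd (u'' x))) with hPdef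
  set e : (Fin (6 + 6) → Bool) → ℤ := fun x => u'' x - sZ (f x) with hedef
  show ∀ y, y ∉ Z → (4 : ℤ) ∣ e y
  by_contra hcon
  push Not at hcon
  obtain ⟨y₀, hy₀, hy₀4⟩ := hcon
  have hP0 : zeroVec ∈ P := tbc_P_zero u''
  have hPadd : ∀ a ∈ P, ∀ b ∈ P, bxor a b ∈ P := tbc_P_add u''
  have hZst : ∀ x ∈ Z, ∀ a ∈ P, bxor x a ∈ Z := fun x hx a ha => tbc_Z_stable u'' hx ha
  have hP : #P = 128 := tbc_card_P g hg u'' hu'' h768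
  have huniv : #(univ : Finset (Fin (6 + 6) → Bool)) = 4096 := by simp
  have hout : ∀ x, x ∉ Z → ∀ p ∈ P, bxor x p ∉ Z := by
    intro x hx p hp h
    apply hx
    have h' := hZst _ h _ hp
    rwa [iw_bxor_assoc, bxor_self, bxor_zeroVec] at h'
  have heven : ∀ x, x ∉ Z → Even (e x) := fun x hx => gh_even_off f u'' x hx
  -- membership in a translate of `Z`
  have himZ : ∀ c d : Fin (6 + 6) → Bool, d ∉ Z.image (bxor c) → bxor c d ∉ Z :=
    fun c d hd h => hd (mem_image.2 ⟨bxor c d, h, bxor_bxor_cancel_left c d⟩)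
  -- the first transversal direction
  obtain ⟨d₁, -, hd₁⟩ : ∃ d₁ ∈ (univ : Finset (Fin (6 + 6) → Bool)), d₁ ∉ P ∪ Z.image (bxor y₀) :=
    exists_mem_notMem_of_card_lt_card (by
      rw [huniv]
      calc #(P ∪ Z.image (bxor y₀)) ≤ #P + #(Z.image (bxor y₀)) := card_union_le _ _
        _ ≤ 128 + 768 := Nat.add_le_add hP.le (card_image_le.trans h768.le)
        _ < 4096 := by norm_num)
  rw [mem_union, not_or] at hd₁
  have hy₁ : bxor y₀ d₁ ∉ Z := himZ y₀ d₁ hd₁.2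
  set V₈ := P ∪ P.image (bxor d₁) with hV₈
  obtain ⟨h80, h8add, h8sub, h8d, -⟩ := fo_double_closed P hP0 hPadd d₁
  have h8card : #V₈ = 256 := by rw [hV₈, tzo_double_card P hPadd d₁ hd₁.1, hP]
  -- the second transversal direction
  obtain ⟨d₂, -, hd₂⟩ : ∃ d₂ ∈ (univ : Finset (Fin (6 + 6) → Bool)),
      d₂ ∉ V₈ ∪ Z.image (bxor y₀) ∪ Z.image (bxor (bxor y₀ d₁)) :=
    exists_mem_notMem_of_card_lt_card (by
      rw [huniv]
      calc #(V₈ ∪ Z.image (bxor y₀) ∪ Z.image (bxor (bxor y₀ d₁)))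
          ≤ #(V₈ ∪ Z.image (bxor y₀)) + #(Z.image (bxor (bxor y₀ d₁))) := card_union_le _ _
        _ ≤ (#V₈ + #(Z.image (bxor y₀))) + #(Z.image (bxor (bxor y₀ d₁))) := Nat.add_le_add_right (card_union_le _ _) _
        _ ≤ (256 + 768) + 768 :=
          Nat.add_le_add (Nat.add_le_add h8card.le (card_image_le.trans h768.le)) (card_image_le.trans h768.le)
        _ < 4096 := by norm_num)
  rw [mem_union, mem_union, not_or, not_or] at hd₂
  have hy₂ : bxor y₀ d₂ ∉ Z := himZ y₀ d₂ hd₂.1.2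
  have hy₁₂ : bxor (bxor y₀ d₁) d₂ ∉ Z := himZ (bxor y₀ d₁) d₂ hd₂.2
  set V₉ := V₈ ∪ V₈.image (bxor d₂) with hV₉
  obtain ⟨h90, h9add, h9sub, h9d, -⟩ := fo_double_closed V₈ h80 h8add d₂
  have h9card : #V₉ = 2 ^ 9 := by rw [hV₉, tzo_double_card V₈ h8add d₂ hd₂.1.1, h8card]; norm_num
  -- the 9-flat `F = y₀ ⊕ V₉` misses `Z`
  set F := V₉.image (bxor y₀) with hF
  have hFZ : ∀ x ∈ F, x ∉ Z := by
    intro x hx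
    obtain ⟨v, hv, rfl⟩ := mem_image.1 hx
    rcases mem_union.1 hv with hv8 | hv8'
    · rcases mem_union.1 hv8 with hvP | hvP'
      · exact hout y₀ hy₀ v hvP
      · obtain ⟨p, hp, rfl⟩ := mem_image.1 hvP'
        rw [← iw_bxor_assoc]
        exact hout _ hy₁ p hp
    · obtain ⟨w, hw, rfl⟩ := mem_image.1 hv8'
      rcases mem_union.1 hw with hwP | hwP'
      · rw [← iw_bxor_assoc]
        exact hout _ hy₂ w hwP
      · obtain ⟨p, hp, rfl⟩ := mem_image.1 hwP'
        have ee : bxor y₀ (bxor d₂ (bxor d₁ p)) = bxor (bxor (bxor y₀ d₁) d₂) p := by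
          rw [iw_bxor_assoc, iw_bxor_assoc, ← iw_bxor_assoc d₁ d₂ p, bxor_comm d₁ d₂, iw_bxor_assoc]
        rw [ee]
        exact hout _ hy₁₂ p hp
  have hFst : ∀ x, x ∈ F → ∀ a ∈ V₉, bxor x a ∈ F := fun x hx a ha => fl1_coset_vadd h9add rfl hx ha
  have hy₀F : y₀ ∈ F := mem_image.2 ⟨zeroVec, h90, bxor_zeroVec y₀⟩
  -- 6-flat sums of the residual are `≡ 0 (mod 4)`
  have hflat6 : ∀ (b : Fin (6 + 6) → Bool) (a : Fin 6 → Fin (6 + 6) → Bool),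
      (4 : ℤ) ∣ ∑ ε : Fin 6 → Bool, e (fun j => b j ^^ decide (Odd #(univ.filter fun i => ε i && a i j))) := by
    intro b a
    have h := gh_flat_dvd (e := 2) f g hf hg u'' hu'' b a (by norm_num) (by norm_num)
    rwa [show ((2 : ℤ) ^ 2) = 4 by norm_num] at h
  -- one round of wild-point parity on `F`
  have hp2 : ∀ y, y ∉ Z → e y = 2 * (e y / 2) := fun y hy =>
    (Int.mul_ediv_cancel' (even_iff_two_dvd.1 (heven y hy))).symm
  rcases ws_erm_round V₉ h90 h9add h9card y₀ (fun y => e y / 2) 5 (fun b hb a ha => by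
      have hpts : ∀ ε : Fin (5 + 1) → Bool, (fun j => b j ^^ decide (Odd #(univ.filter fun i => ε i && a i j))) ∈ F :=
        fun ε => ws_flatPt_mem V₉ h90 (· ∈ F) hFst (5 + 1) b hb a ha ε
      have h4 := hflat6 b a
      rw [sum_congr rfl fun ε _ => hp2 _ (hFZ _ (hpts ε)), ← mul_sum] at h4
      obtain ⟨k, hk⟩ := h4
      exact ⟨k, by linarith⟩) with hev | hbig
  · have h := hev y₀ hy₀F
    apply hy₀4
    obtain ⟨k, hk⟩ := h
    exact ⟨k, by rw [hp2 y₀ hy₀, hk]; ring⟩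
  · have hcount : (4 : ℤ) * #(F.filter fun x => Odd (e x / 2)) ≤ 63 := by
      calc (4 : ℤ) * #(F.filter fun x => Odd (e x / 2)) = ∑ x ∈ F.filter (fun x => Odd (e x / 2)), (4 : ℤ) := by
            rw [sum_const, nsmul_eq_mul, mul_comm]
        _ ≤ ∑ x ∈ F.filter (fun x => Odd (e x / 2)), e x ^ 2 := by
            refine sum_le_sum fun x hx => ?_
            have hx' := mem_filter.1 hx
            have hxZ : x ∉ Z := hFZ x hx'.1
            have h0' := Int.odd_iff.1 hx'.2
            have h2 := hp2 x hxZ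
            have : e x ≤ -2 ∨ 2 ≤ e x := by omega
            have := tp_sq_ge (k := 2) (by norm_num) this
            linarith
        _ ≤ ∑ x ∈ univ.filter (fun x => x ∉ Z), e x ^ 2 :=
            sum_le_sum_of_subset_of_nonneg (fun x hx => mem_filter.2 ⟨mem_univ _, hFZ x (mem_filter.1 hx).1⟩)
              fun x _ _ => sq_nonneg _
        _ ≤ 63 := hoff
    change 2 ^ 9 ≤ 2 ^ 5 * #(F.filter fun x => Odd (e x / 2)) at hbig
    norm_num at hbig
    have : (16 : ℤ) ≤ #(F.filter fun x => Odd (e x / 2)) := by exact_mod_cast (by omega)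
    linarith

end Summit.QuantumAdvantage.QuantumAdvantage.Theorems.CubicForrelation.NearExactIsExact

end
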